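import Summits.QuantumFields.BalabanUV.T4Continuum.Spine.NE9.CarriersOfRecordFacesTR
import Summits.QuantumFields.BalabanUV.T4Continuum.Support.NE9TorusIneq126ChainSum

/-!
# NE9RecordIneq126Chain — [II] (1.26) ON THE CARRIERS OF RECORD from the BLOCK CHAIN (`2²⁰ + 2⁵·Γ₄³·e^{−(κ−κ₁)}`, `79 < κ₁ < 80`,
# `2⁵·Γ₄³ < 2.74·10²⁷`, in place of `K₀(64,8) = 162⁶⁴/81 ∈ (10¹³⁹, 10¹⁴⁰)` at `κ₀ = 64·log 162 ≈ 325.6`), and the A1-KP producer of the NE9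
# carriers-of-record face re-instantiated with THIS socket (cell `pub-balaban`, T4-DAG §2 node U3 / §6 rows NE9 ∕ NE5; NE9 formalisation swarm
# LEAF PROVER 05, lineage leaf-05, generation 4; part C of the lineage item — parts A `NE9TreeBlockChain` p212919, B1 `NE9TorusIneq126Chain`,
# B2 `NE9TorusIneq126ChainSum`; the sibling of generation 3's `NE9RecordIneq126Above` p212130 with the block-chain socket for the volume-leaf one)

HONEST FRAMING (T4-DAG PAGE 1).  Rung (B)+1 of the FINITE-VOLUME T⁴ programme — existence AND uniqueness of the ε → 0 limit of
gauge-invariant observables on a fixed torus; NOT infinite volume, NOT a mass gap, NOT the Clay problem.  NE9 (`T4OutputRate.NE9` ∧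
`FadingMemory`) is a cell NEW ESTIMATE, NOT PRINTED, and is NOT discharged here («NE9 ⇐ the named binders»); spine 0/9 unchanged; 0/18
leaves instantiated on Bałaban's objects.  HONEST DEPENDENCY (cell line, verbatim): continuum YM on T⁴ ⇐ BetaPertH ∧ nine spine estimates
(0/9 proved); BetaPertH ⇐ (D1) ∧ (D4) ∧ CAP+tail; G-an2-4 gates asym, D1 and NE2/3/4.  `FlowStep.BetaPertH`, (B), (B^μ) do not occur here.
[II] = [Balaban1988RG2Cluster] is quoted for TYPES only (ABSOLUTE RULE: nothing printed in the audited series is asserted).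

THE LOCATED POINT (FINDING F-ne9leaf05g3-1, census class; numbers, not adjectives).  On the NE9 carriers-of-record face
(`Spine/NE9/CarriersOfRecordFacesTR`, p211088) the A1-KP conjunct is produced in the PRINTED currency `d_j = torusTreeLen` by NE5-P2's
`B13DomainGeometryTR.kpInflated_b13` (threshold form, `κ₀ = 64·log 162`, `K₀(64,8) ∈ (10¹³⁹, 10¹⁴⁰)`) or by generation 3's `kpInflated_b13_above`
(same threshold, constant `2²⁰ + K₀(64,8)e^{−s′}`, rate room `(64·log 162 + s′) + σ + 64τ ≤ R` with `s′ ≈ 321` before the constant is `2²⁰ + O(1)`).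
THIS FILE swaps the (1.26) socket for part B2's block-chain one (kernel, no new definition, no `def … : Prop`, 0 sorry):
* §1 **on the carriers of record** `B13Carriers.TwoRuns.carriers`: `ineq126_level_chain` — for `κ ≥ κ₁(4) + 1`,
  `Ineq126 (R.domAt k) footprint d κ (2²⁰ + 2⁵·Γ₄³·e^{−(κ−κ₁(4))})` (part B2 `ineq126_chain` transported along `domEmb` exactly as NE5-P2's
  `ineq126_level` transports `TreeLengthTorus.ineq126_torus`), the remark's form `sum_filter_d_ne_zero_le_record_chain`, and the corner
  `ineq126_level_chain_144`: constant `2²⁰ + 1` from `κ ≥ 144` (part B2 `ineq126_chain_four`);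
* §2 **the re-instantiated producer** `kpInflated_b13_chain` = `ClusterRepKP.kpInflated_of_majorant` fed with §1 at the rate `κ₁(4) + s′`, `s′ ≥ 1`:
  rate room `(κ₁(4) + s′) + σ + 64τ ≤ R`, smallness `(1+s)·A·e^{5σ+64τ}·(2²⁰ + 2⁵·Γ₄³·e^{−s′})·9 ≤ τ` — at `s′ = 64` the constant is `< 2²⁰ + 1`
  and the rate floor is `κ₁(4) + 64 < 144` (versus `64·log 162 + 321 ≈ 647` for the same constant on the volume-leaf route);
* §3 the A1-KP conjunct of the NE9 END on the carriers of record from it, BY NAME through `twoPointKP_of_kpInflated` (leaf-05-g2).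
Nothing of `B13DomainGeometryTR` (t4-ne5-p2), `CarriersOfRecordFacesTR` (leaf-05-g2) or `NE9RecordIneq126Above` (leaf-05-g3) is modified; the
threshold producers stay as they are (this is a sibling, not a replacement).  DISGUISE TEST: one transport of a geometric count plus a
re-instantiation; the (2.38)-shaped majorant stays a DISPLAYED hypothesis shape (NODE O's); no history — not NE9, not NE5.

References (TYPES only): T. Bałaban, *Renormalization group approach to lattice gauge field theories. II. Cluster expansions*, Commun.
Math. Phys. **116**, 1–22 (1988) [Balaban1988RG2Cluster], (1.26) p. 8 (remark l. 11–13), Lemma 3 (2.38) p. 20 (shape only).  Summits-side NEW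
work (LEAN PLACEMENT RULE); imports `Spine.NE9.CarriersOfRecordFacesTR` and part B2 only; 0 sorry.  Value = kernel bookkeeping (a producer's
rate floor brought from ≈ 647 to < 144 and its constant from `10^{139.5}` to `2²⁰ + 1` by a theorem of the cell's geometry), NOT summit progress.
-/

noncomputable section

open scoped BigOperators

namespace Summit.QuantumFields.BalabanUV.T4Continuum.NE9RecordIneq126Chain

open Literature.MathematicalPhysics.QuantumFieldTheory.Balaban1983to89
open Literature.MathematicalPhysics.QuantumFieldTheory.Balaban1983to89.TreeLengthTorus
open Literature.MathematicalPhysics.QuantumFieldTheory.Balaban1983to89.B13FamilySum (Ineq126)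
open Literature.MathematicalPhysics.QuantumFieldTheory.Balaban1983to89.T4ActivityRecursion (KPInflated)
open Literature.MathematicalPhysics.QuantumFieldTheory.Balaban1983to89.T4HistoryLipschitzActivity
open Literature.MathematicalPhysics.QuantumFieldTheory.Balaban1983to89.T4HistoryLipschitzActivity (ClusterGeom)
open Literature.MathematicalPhysics.QuantumFieldTheory.Balaban1983to89.T4HistoryLipschitzSegment (TwoPointKP)
open Summit.QuantumFields.BalabanUV.T4Continuum.B13Carriers (TwoRuns)
open Summit.QuantumFields.BalabanUV.T4Continuum.B13DomainGeometryTR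
open Summit.QuantumFields.BalabanUV.T4Continuum.ClusterRepKP (kpInflated_of_majorant)
open Summit.QuantumFields.BalabanUV.T4Continuum.NE9.CarriersOfRecordFacesTR (twoPointKP_of_kpInflated)
open Summit.QuantumFields.BalabanUV.T4Continuum.NE9TorusIneq126Chain (chainConst kappa₁ chainConst_pos)
open Summit.QuantumFields.BalabanUV.T4Continuum.NE9TorusIneq126ChainSum
  (ineq126_chain sum_filter_ne_zero_le_chain_exp socketConst_four_lt_exp kappa₁_four_lt)

/-! ## §1 (1.26) from the block chain ON THE CARRIERS OF RECORD -/

section Record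

variable {G : Type} [GaugeGroup G] (R : TwoRuns G)

/-- **[II] (1.26) ON THE CARRIERS OF RECORD, BLOCK-CHAIN SOCKET** (every scale, every cube): for `κ ≥ κ₁(4) + 1` (`κ₁(4) < 80`),
`Σ_{Y ∈ 𝐃_k, Y ∋ c} e^{−κ d(Y)} ≤ 2²⁰ + 2⁵·Γ₄³·e^{−(κ − κ₁(4))}` — part B2's `ineq126_chain` over the torus domains of scale `k`, transported along
`domEmb` as in NE5-P2's `ineq126_level`. [cite: Balaban1988RG2Cluster, (1.26) p.8] -/
theorem ineq126_level_chain (k : ℕ) {κ : ℝ} (hκ : kappa₁ 4 + 1 ≤ κ) :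
    Ineq126 (R.domAt k) (fun X => footprint X) R.carriers.d κ
      (2 ^ 20 + 2 ^ 5 * chainConst 4 ^ 3 * Real.exp (-(κ - kappa₁ 4))) := by
  classical
  intro c
  have hC : (0 : ℝ) ≤ 2 ^ 20 + 2 ^ 5 * chainConst 4 ^ 3 * Real.exp (-(κ - kappa₁ 4)) := by
    have := chainConst_pos 4
    positivity
  rw [domAt_eq_map, Finset.filter_map, Finset.sum_map]
  by_cases hc : c.1 = k
  · obtain ⟨j, q⟩ := c
    simp only at hc
    subst hc
    set S : Finset (Finset (TPt 4 (R.cubesPerDir j))) :=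
      (Finset.univ : Finset (TDom 4 (R.cubesPerDir j))).image Subtype.val with hSdef
    have hS : ∀ Y ∈ S, Y.Nonempty ∧ TFaceConnected Y := by
      intro Y hY
      obtain ⟨Z, -, rfl⟩ := Finset.mem_image.1 hY
      exact Z.2
    have h := ineq126_chain S hS hκ q
    have h16 : (2 : ℝ) ^ 4 * 2 ^ (2 ^ 4) + 2 ^ (4 + 1) * chainConst 4 ^ 3 * Real.exp (-(κ - kappa₁ 4))
        = 2 ^ 20 + 2 ^ 5 * chainConst 4 ^ 3 * Real.exp (-(κ - kappa₁ 4)) := by norm_num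
    rw [h16] at h
    refine le_trans (le_of_eq ?_) h
    refine Finset.sum_bij (fun Z _ => Z.1) ?_ ?_ ?_ ?_
    · intro Z hZ
      have hq : q ∈ Z.1 := mk_mem_footprint_iff.1 (Finset.mem_filter.1 hZ).2
      have hZu : Z ∈ (Finset.univ : Finset (TDom 4 (R.cubesPerDir j))) := Finset.mem_univ Z
      exact Finset.mem_filter.2 ⟨Finset.mem_image_of_mem Subtype.val hZu, hq⟩
    · intro Z _ Z' _ h
      exact Subtype.ext h
    · intro Y hY
      obtain ⟨hYS, hqY⟩ := Finset.mem_filter.1 hY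
      obtain ⟨Z, -, rfl⟩ := Finset.mem_image.1 hYS
      exact ⟨Z, Finset.mem_filter.2 ⟨Finset.mem_univ _, mk_mem_footprint_iff.2 hqY⟩, rfl⟩
    · intro Z _
      rfl
  · -- a cube of another scale lies in no footprint of scale `k`
    have hempty : (Finset.univ.filter fun Z : TDom 4 (R.cubesPerDir k) =>
        c ∈ footprint ((domEmb R k) Z)) = ∅ := by
      refine Finset.filter_false_of_mem fun Z _ hcZ => hc ?_
      exact (fst_eq_of_mem_footprint hcZ).trans rfl
    simp only [Function.comp_def]
    rw [hempty, Finset.sum_empty]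
    exact hC

/-- The remark's form on the carriers of record ([Balaban1988RG2Cluster] p. 8 l. 11–13, *"The number O(1) is in fact small, because we sum
over X with d_j(X) ≠ 0"*, quoted as a TYPE): for `κ ≥ κ₁(4) + 1`, the part of the (1.26)-sum over the domains with `d ≠ 0` is at most
`2⁵·Γ₄³·e^{−(κ − κ₁(4))}`. [cite: Balaban1988RG2Cluster, (1.26) p.8] -/
theorem sum_filter_d_ne_zero_le_record_chain (k : ℕ) {κ : ℝ} (hκ : kappa₁ 4 + 1 ≤ κ) (c : SCube R) :
    ∑ Y ∈ ((R.domAt k).filter fun Y => c ∈ footprint Y).filter (fun Y => R.carriers.d Y ≠ 0), Real.exp (-(κ * R.carriers.d Y))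
      ≤ 2 ^ 5 * chainConst 4 ^ 3 * Real.exp (-(κ - kappa₁ 4)) := by
  classical
  have hC : (0 : ℝ) ≤ 2 ^ 5 * chainConst 4 ^ 3 * Real.exp (-(κ - kappa₁ 4)) := by
    have := chainConst_pos 4
    positivity
  rw [Finset.filter_filter, domAt_eq_map, Finset.filter_map, Finset.sum_map]
  by_cases hc : c.1 = k
  · obtain ⟨j, q⟩ := c
    simp only at hc
    subst hc
    set S : Finset (Finset (TPt 4 (R.cubesPerDir j))) :=
      (Finset.univ : Finset (TDom 4 (R.cubesPerDir j))).image Subtype.val with hSdef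
    have hS : ∀ Y ∈ S, Y.Nonempty ∧ TFaceConnected Y := by
      intro Y hY
      obtain ⟨Z, -, rfl⟩ := Finset.mem_image.1 hY
      exact Z.2
    have h := sum_filter_ne_zero_le_chain_exp S hS q hκ
    have h5 : (2 : ℝ) ^ (4 + 1) = 2 ^ 5 := by norm_num
    rw [h5, Finset.filter_filter] at h
    refine le_trans (le_of_eq ?_) h
    refine Finset.sum_bij (fun Z _ => Z.1) ?_ ?_ ?_ ?_
    · intro Z hZ
      obtain ⟨-, hq, hne⟩ := Finset.mem_filter.1 hZ
      have hZu : Z ∈ (Finset.univ : Finset (TDom 4 (R.cubesPerDir j))) := Finset.mem_univ Z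
      exact Finset.mem_filter.2 ⟨Finset.mem_image_of_mem Subtype.val hZu, mk_mem_footprint_iff.1 hq, hne⟩
    · intro Z _ Z' _ h
      exact Subtype.ext h
    · intro Y hY
      obtain ⟨hYS, hqY, hne⟩ := Finset.mem_filter.1 hY
      obtain ⟨Z, -, rfl⟩ := Finset.mem_image.1 hYS
      exact ⟨Z, Finset.mem_filter.2 ⟨Finset.mem_univ _, mk_mem_footprint_iff.2 hqY, hne⟩, rfl⟩
    · intro Z _
      rfl
  · have hempty : (Finset.univ.filter fun Z : TDom 4 (R.cubesPerDir k) =>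
        c ∈ footprint ((domEmb R k) Z) ∧ R.carriers.d ((domEmb R k) Z) ≠ 0) = ∅ := by
      refine Finset.filter_false_of_mem fun Z _ hcZ => hc ?_
      exact (fst_eq_of_mem_footprint hcZ.1).trans rfl
    simp only [Function.comp_def]
    rw [hempty, Finset.sum_empty]
    exact hC

/-- **THE CORNER ON THE CARRIERS OF RECORD**: for `κ ≥ 144` (every scale, every cube), `Σ_{Y ∈ 𝐃_k, Y ∋ c} e^{−κ d(Y)} ≤ 2²⁰ + 1` — the
block-chain tail `2⁵·Γ₄³·e^{−(κ−κ₁)}` is `≤ 1` there (`2⁵Γ₄³ < e⁶⁴`, `κ₁(4) < 80`).  Generation 3's `ineq126_level_at_double` reaches the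
constant `2²⁰ + 1/81` at `κ = 128·log 162 ≈ 651`. [cite: Balaban1988RG2Cluster, (1.26) p.8] -/
theorem ineq126_level_chain_144 (k : ℕ) {κ : ℝ} (hκ : 144 ≤ κ) :
    Ineq126 (R.domAt k) (fun X => footprint X) R.carriers.d κ (2 ^ 20 + 1) := by
  have hk := kappa₁_four_lt
  intro c
  refine (ineq126_level_chain R k (by linarith) c).trans ?_
  have h1 : Real.exp (-(κ - kappa₁ 4)) ≤ Real.exp (-64) := Real.exp_le_exp.2 (by linarith)
  have h2 := socketConst_four_lt_exp
  have h3 : (0 : ℝ) ≤ 2 ^ 5 * chainConst 4 ^ 3 := by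
    have := chainConst_pos 4
    positivity
  have h5 : (2 : ℝ) ^ (4 + 1) = 2 ^ 5 := by norm_num
  rw [h5] at h2
  have htail : (2 : ℝ) ^ 5 * chainConst 4 ^ 3 * Real.exp (-(κ - kappa₁ 4)) ≤ 1 :=
    calc (2 : ℝ) ^ 5 * chainConst 4 ^ 3 * Real.exp (-(κ - kappa₁ 4))
        ≤ 2 ^ 5 * chainConst 4 ^ 3 * Real.exp (-64) := mul_le_mul_of_nonneg_left h1 h3
      _ ≤ Real.exp 64 * Real.exp (-64) := mul_le_mul_of_nonneg_right h2.le (Real.exp_pos _).le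
      _ = 1 := by rw [← Real.exp_add]; norm_num
  linarith

/-! ## §2 The re-instantiated A1-KP producer on the carriers of record -/

/-- **L03 ∕ A1-KP ON BAŁABAN's DOMAINS WITH THE BLOCK-CHAIN SOCKET** — `B13DomainGeometryTR.kpInflated_b13` (t4-ne5-p2) ∕ generation 3's
`kpInflated_b13_above`, re-instantiated through `ClusterRepKP.kpInflated_of_majorant` with (1.26) taken from §1 at the rate `κ₁(4) + s′`,
`s′ ≥ 1`: from a nonnegative majorant `m ≤ A·e^{−R·d}` on every `𝐃_k` (hypothesis SHAPE with locator [II] Lemma 3 (2.38) p. 20 — asserted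
nowhere), the rate room `(κ₁(4) + s′) + σ + 64τ ≤ R` and the smallness `(1+s)·A·e^{5σ+64τ}·(2²⁰ + 2⁵·Γ₄³·e^{−s′})·9 ≤ τ`.  At `s′ = 64` the
constant is `< 2²⁰ + 1` and the rate floor `κ₁(4) + 64 < 144`; generation 3's producer needs `64·log 162 + s′` with `s′ ≈ 321` for the same
constant. [folklore] -/
theorem kpInflated_b13_chain (ρA ρB : (ℕ → ℝ) → R.carriers.BgB → R.carriers.Dom → ℂ) {W : Set (ℕ → ℝ)}
    {m : (ℕ → ℝ) → R.carriers.BgB → R.carriers.Dom → ℝ} {A Rm τ σ s s' : ℝ}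
    (hA : 0 ≤ A) (hτ : 0 ≤ τ) (hσ : 0 ≤ σ) (hs : 0 ≤ s) (hs' : 1 ≤ s')
    (hm0 : ∀ g U Z, 0 ≤ m g U Z)
    (hm : ∀ g ∈ W, ∀ U (k : ℕ), ∀ Z ∈ R.domAt k, m g U Z ≤ A * Real.exp (-(Rm * R.carriers.d Z)))
    (hrate : (kappa₁ 4 + s') + σ + τ * 64 ≤ Rm)
    (hsmall : (1 + s) * A * Real.exp (σ * 5 + τ * 64) * (2 ^ 20 + 2 ^ 5 * chainConst 4 ^ 3 * Real.exp (-s')) * 9 ≤ τ) :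
    KPInflated (clusterRep R ρA ρB) W m s (fun Z => τ * ((footprint Z).card : ℝ))
      (fun Z => σ * R.carriers.d Z + σ * 5) := by
  have h126 : ∀ k, Ineq126 (R.domAt k) (fun X => footprint X) R.carriers.d (kappa₁ 4 + s')
      (2 ^ 20 + 2 ^ 5 * chainConst 4 ^ 3 * Real.exp (-s')) := by
    intro k
    have h := ineq126_level_chain R k (κ := kappa₁ 4 + s') (by linarith)
    rwa [show -(kappa₁ 4 + s' - kappa₁ 4) = -s' by ring] at h
  have hC : 0 ≤ (2 : ℝ) ^ 20 + 2 ^ 5 * chainConst 4 ^ 3 * Real.exp (-s') := by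
    have := chainConst_pos 4
    positivity
  exact kpInflated_of_majorant (domainGeometry R) ρA ρB reach R.carriers.d loc_b13 reach_b13
    R.carriers.d_nonneg hA hC hτ hσ (mul_nonneg hσ (by norm_num)) hs hm0 hm h126 volBound_level hrate hsmall

/-! ## §3 The A1-KP conjunct of the NE9 END on the carriers of record, from the block-chain producer -/

variable {Pot : Type} [NormedAddCommGroup Pot] [NormedSpace ℂ Pot]

omit [NormedSpace ℂ Pot] in
/-- **A1-KP ON THE CARRIERS OF RECORD, PRINTED CURRENCY, BLOCK-CHAIN SOCKET** (bookkeeping): `CarriersOfRecordFacesTR.twoPointKP_of_kpInflated`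
(leaf-05-g2, p211088) fed BY NAME with `kpInflated_b13_chain` at inflation `s = 1` and the majorant read through the creation step of the
polymer — `TwoPointKP` on `ClusterGeom.ofRep (clusterRep R ρA ρB)` from the two activity-level clauses (size, two-point in the table),
`0 ≤ lip k`, the displayed (2.38)-SHAPED majorant `n (scale Z − 1) (g (scale Z − 1)) U Z ≤ A·e^{−R·d Z}` on every `𝐃_k`, the rate room
`(κ₁(4) + s′) + σ + 64τ ≤ R` (`s′ ≥ 1`) and the smallness `2·A·e^{5σ+64τ}·(2²⁰ + 2⁵·Γ₄³·e^{−s′})·9 ≤ τ`.  The (2.38)-shaped majorant itself stays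
NODE O's; nothing about Bałaban's activities is discharged. [folklore] -/
theorem twoPointKP_record_chain (ρA ρB : (ℕ → ℝ) → R.carriers.BgB → R.carriers.Dom → ℂ) {W : Set (ℕ → ℝ)}
    {act : ℕ → ℝ → R.carriers.BgB → Pot → (ClusterGeom.ofRep (clusterRep R ρA ρB)).P → ℂ} {𝒜 : ℕ → Set Pot}
    {n : ℕ → ℝ → R.carriers.BgB → (ClusterGeom.ofRep (clusterRep R ρA ρB)).P → ℝ} {lip : ℕ → ℝ}
    {A Rm τ σ s' : ℝ} (hlip : ∀ k, 0 ≤ lip k)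
    (hsize : ∀ g ∈ W, ∀ (k : ℕ) (U : R.carriers.BgB) (X : R.carriers.Dom), R.carriers.scale X = k + 1 → ∀ Q ∈ 𝒜 k,
      ∀ γ ∈ (ClusterGeom.ofRep (clusterRep R ρA ρB)).vol X, ‖act k (g k) U Q γ‖ ≤ n k (g k) U γ)
    (htwo : ∀ g ∈ W, ∀ (k : ℕ) (U : R.carriers.BgB) (X : R.carriers.Dom), R.carriers.scale X = k + 1 → ∀ Q ∈ 𝒜 k,
      ∀ Q' ∈ 𝒜 k, ∀ γ ∈ (ClusterGeom.ofRep (clusterRep R ρA ρB)).vol X,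
        ‖act k (g k) U Q γ - act k (g k) U Q' γ‖ ≤ lip k * ‖Q - Q'‖ * n k (g k) U γ)
    (hA : 0 ≤ A) (hτ : 0 ≤ τ) (hσ : 0 ≤ σ) (hs' : 1 ≤ s')
    (hn0 : ∀ (g : ℕ → ℝ) (U : R.carriers.BgB) (Z : R.carriers.Dom), 0 ≤ n (R.carriers.scale Z - 1) (g (R.carriers.scale Z - 1)) U Z)
    (hm : ∀ g ∈ W, ∀ (U : R.carriers.BgB) (k : ℕ), ∀ Z ∈ R.domAt k,
      n (R.carriers.scale Z - 1) (g (R.carriers.scale Z - 1)) U Z ≤ A * Real.exp (-(Rm * R.carriers.d Z)))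
    (hrate : (kappa₁ 4 + s') + σ + τ * 64 ≤ Rm)
    (hsmall : (1 + 1) * A * Real.exp (σ * 5 + τ * 64) * (2 ^ 20 + 2 ^ 5 * chainConst 4 ^ 3 * Real.exp (-s')) * 9 ≤ τ) :
    TwoPointKP (ClusterGeom.ofRep (clusterRep R ρA ρB)) W act 𝒜 n lip (fun Z => τ * ((footprint Z).card : ℝ))
      (fun Z => σ * R.carriers.d Z + σ * 5) :=
  twoPointKP_of_kpInflated R ρA ρB hlip hsize htwo
    (kpInflated_b13_chain R ρA ρB hA hτ hσ zero_le_one hs' hn0 hm hrate hsmall)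

end Record

end Summit.QuantumFields.BalabanUV.T4Continuum.NE9RecordIneq126Chain

end
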